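import Literature.MathematicalPhysics.QuantumFieldTheory.Balaban1983to89.B9Ineq369CurvatureOperatorBound

/-!
# `Balaban1983to89.B9Ineq369CurvatureTwoBackgrounds` — T. Bałaban, *Propagators for lattice gauge theories in a background field*, Commun. Math.
# Phys. **99** (1985) 389–434 [Balaban1985BackgroundPropagators] (3.10) p. 392 with (3.69) p. 404: THE CURVATURE PART `Δ′(U)` OF THE HESSIAN IS
# LIPSCHITZ IN THE BACKGROUND BETWEEN TWO UNIT-BOUNDED BACKGROUNDS — `‖Δ′(U)x − Δ′(U′)x‖ ≤ 384d·C_τ·M_φ²·(|η|^d∕c₀)·|η|⁻²·δ·‖x‖` for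
# `‖U(b) − U′(b)‖ ≤ δ` and plaquette holonomies of `U` within `ε ≤ 1` of `1` (the polarised quadratic-form bound of `B9Ineq369CurvatureOperatorBound`
# run on the DIFFERENCE of the two curvature forms)

statement-level skeleton of published theorems with citation tags; proofs where landed; nothing here is a claim about the Yang–Mills mass gap

PDF held: `paper:balaban1985-cmp99-background-propagators` (journal page = PDF page + 388); pp. 390–392, 404 through the verbatim quotations of
`B9Eq310DeltaPrime` ∕ `B9Ineq369CurvatureSmall` ∕ `B9Ineq369CurvatureOperatorBound` (NE9 owner gens 77–80), whose architecture this file mirrors.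

CITATION HEADER (lean-in-tree rule 2026-08-18).  Audit cell `pub-balaban`, sub-cell `t4`, NE9 crux team (2): LEAF PROVER 04
(`b2b-balaban-t4-ne9-formalise-leaf-04` gen 73) — the TWO-BACKGROUND twin of `B9Ineq369CurvatureOperatorBound.norm_curvOp_le` (there: `Δ′(1) = 0`,
so `‖Δ′(U)‖ = O(ε)` is the flat-point Lipschitz letter); companion of this lineage's two-background letters (δ_Q)₂ ∕ (B)₂ ∕ (ρ′)₂ ∕ (Q3a)₂ ∕ (Q1)₂ for the
NE9 owner's census item (i) «two general small fields» (journal `CLAIMS.log` l.42142): the full `Δ_a(U) = P(U) + Δ′(U) + …` between two backgrounds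
needs the curvature part compared at `U` and `U′`, not only bounded at each.

THE PRINT (as quoted in `B9Eq310DeltaPrime`).  (3.10) p. 392: *«⟨A, Δ′A⟩ = Σ_{p⊂T_η} η^d [ tr((D^η_U A)(p))²(Re U(∂p) − 1) + tr (Σ_{b₁,b₂⊂∂(p)_z, b₁≺b₂}
i[A′(b₁), A′(b₂)]) η⁻² Im U(∂p) ]»*; p. 392: *«the operator Δ′ will be a bounded, small operator»*; (3.69) p. 404 (the smallness from (3.35)).

WHAT IS PROVED (sorry-free; no definition; [folklore] bookkeeping on the tree's (3.10) objects).
* §1 per plaquette (private product telescoping `norm_mul_sub_mul_le₁`, `norm_mul₃_sub_le`): **`norm_plaqHolU_sub_le`** (`‖U(∂p) − U′(∂p)‖ ≤ 4δ`),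
  `norm_reHol_sub_le` ∕ `norm_imHol_sub_le` (`≤ 4δ`), `norm_edgeLin_sub_le` (`≤ 2δ‖A(b)‖`), `norm_curlAt_sub_le` (`≤ |c|·2δ·Σ_{∂p}‖A‖`),
  **`norm_curvBlock₁_sub_le`** (`≤ 8C_τ|η|⁻²δ·(Σ_{∂p}‖A‖)(Σ_{∂p}‖B‖)`), **`norm_curvBlock₂_sub_le`** (`≤ 16C_τ|η|⁻²δ·(…)(…)`),
  **`norm_curvForm_sub_le`** (`‖⟨A, (Δ′(U) − Δ′(U′))B⟩‖ ≤ 24·C_τ·δ·|η|^d·|η|⁻²·Σ_p (Σ_{∂p}‖A‖)(Σ_{∂p}‖B‖)`).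
* §2 on the `L²` bond space: **`norm_inner_curvOp_sub_le`**, **`norm_curvOp_sub_le`** — `‖Δ′(U)x − Δ′(U′)x‖ ≤ 384d·C_τ·M_φ²·(|η|^d∕c₀)·(|η|⁻²δ)·‖x‖`.
MODEL / DECLARED READINGS.  (M1) as `B9Ineq369CurvatureOperatorBound`: periodic lattice, fibre `W` read in `𝔸` along `φ` (`‖φw‖ ≤ M_φ‖w‖`), `τ` bounded by
`C_τ`, weight `c₀`; BOTH backgrounds unit-bounded with unit-bounded inverses; the plaquette holonomies of `U` within `ε ≤ 1` of `1` (the chain's (3.35)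
regime gives far more), `U′` only `δ`-close to `U` bondwise.  (M2) crude constants (`8`, `16`, `24`, `384d`): every product difference telescoped with
all factors of norm `≤ 1`, `ε ≤ 1` used to merge the `δε`- and `δ`-terms.
HONEST SCOPE.  Elementary; one displayed letter of a two-general-backgrounds chart of the NE9 chain, NOT that chart, NOT NE9; NOT summit progress (cell
pub-balaban: NE9 NOT PRINTED ∕ NOT PROVED; spine PROVED 0∕9; rung (B)+1 finite T⁴ — NOT infinite volume, NOT mass gap, NOT Clay).  NEW file importing
`B9Ineq369CurvatureOperatorBound` only; nothing of the NE9-owner lineage's files is modified.  Net new unproved facts: 0.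
-/

noncomputable section

open scoped InnerProductSpace ComplexConjugate BigOperators
open Finset

namespace Literature.MathematicalPhysics.QuantumFieldTheory.Balaban1983to89.B9Ineq369CurvatureTwoBackgrounds

open B9SectCLatticeCarrier (Bond DirPair shift)
open B4Sect5Torus (TSite)
open B9Eq311L2Pairing (WL2)
open B9Eq310DeltaPrime (plaqHolU reHol imHol edgeLin edgeLin_zero edgeLin_one edgeLin_two edgeLin_three curlAt curlAt_eq_smul_sum_edgeLin
  orderedPairs mem_orderedPairs curvBlock₁ curvBlock₁_apply curvBlock₂ curvBlock₂_apply curvForm curvForm_apply)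
open B9Eq310HessianOperator (toAlg curvOp inner_curvOp)
open B11Eq103H1Complex (BondL2K)
open B9Ineq369CurvatureSmall (edgeBond edgeSum edgeSum_nonneg sum_edge_le norm_conj_le norm_edgeLin_le norm_curlAt_le norm_plaqHolU_le
  norm_reHol_sub_one_le norm_imHol_le)
open B9Ineq369CurvatureOperatorBound (sum_edgeSum_sq_le)

variable {d : ℕ} {Pd : Fin d → ℕ}

/-! ## §1 Per-plaquette differences: every ingredient of (3.10) is `O(δ)`-Lipschitz in the background -/

section Plaquette

variable {𝔸 : Type*} [NormedRing 𝔸] [NormedAlgebra ℂ 𝔸]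

omit [NormedAlgebra ℂ 𝔸] in
/-- `‖ab − a′b′‖ ≤ ‖a − a′‖ + ‖b − b′‖` for `‖a‖ ≤ 1`, `‖b′‖ ≤ 1` (`ab − a′b′ = a(b − b′) + (a − a′)b′`). [folklore] -/
private theorem norm_mul_sub_mul_le₁ {a a' b b' : 𝔸} (ha : ‖a‖ ≤ 1) (hb' : ‖b'‖ ≤ 1) : ‖a * b - a' * b'‖ ≤ ‖a - a'‖ + ‖b - b'‖ := by
  rw [show a * b - a' * b' = a * (b - b') + (a - a') * b' by noncomm_ring]
  calc _ ≤ ‖a * (b - b')‖ + ‖(a - a') * b'‖ := norm_add_le _ _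
    _ ≤ ‖a‖ * ‖b - b'‖ + ‖a - a'‖ * ‖b'‖ := add_le_add (norm_mul_le _ _) (norm_mul_le _ _)
    _ ≤ 1 * ‖b - b'‖ + ‖a - a'‖ * 1 := by gcongr
    _ = ‖a - a'‖ + ‖b - b'‖ := by ring

variable {U U' : Bond d Pd → 𝔸ˣ} (hU : ∀ b, ‖(U b : 𝔸)‖ ≤ 1 ∧ ‖(((U b)⁻¹ : 𝔸ˣ) : 𝔸)‖ ≤ 1)
  (hU' : ∀ b, ‖(U' b : 𝔸)‖ ≤ 1 ∧ ‖(((U' b)⁻¹ : 𝔸ˣ) : 𝔸)‖ ≤ 1) {δ : ℝ} (hUU' : ∀ b, ‖(U b : 𝔸) - (U' b : 𝔸)‖ ≤ δ)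

omit [NormedAlgebra ℂ 𝔸] in
include hU hU' hUU' in
/-- the inverses of two unit-bounded bond variables are as close as the variables: `‖U(b)⁻¹ − U′(b)⁻¹‖ ≤ δ` (`= U⁻¹(U′ − U)U′⁻¹`).
[cite: Balaban1985BackgroundPropagators, (3.5) p.391] -/
theorem norm_inv_sub_inv_le (b : Bond d Pd) : ‖(((U b)⁻¹ : 𝔸ˣ) : 𝔸) - (((U' b)⁻¹ : 𝔸ˣ) : 𝔸)‖ ≤ δ := by
  have h : (((U b)⁻¹ : 𝔸ˣ) : 𝔸) - (((U' b)⁻¹ : 𝔸ˣ) : 𝔸) = (((U b)⁻¹ : 𝔸ˣ) : 𝔸) * ((U' b : 𝔸) - (U b : 𝔸)) * (((U' b)⁻¹ : 𝔸ˣ) : 𝔸) := by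
    rw [mul_sub, sub_mul, mul_assoc, Units.mul_inv, mul_one, Units.inv_mul, one_mul]
  rw [h]
  calc _ ≤ ‖(((U b)⁻¹ : 𝔸ˣ) : 𝔸)‖ * ‖(U' b : 𝔸) - (U b : 𝔸)‖ * ‖(((U' b)⁻¹ : 𝔸ˣ) : 𝔸)‖ :=
        (norm_mul_le _ _).trans (mul_le_mul_of_nonneg_right (norm_mul_le _ _) (norm_nonneg _))
    _ ≤ 1 * ‖(U' b : 𝔸) - (U b : 𝔸)‖ * 1 := by gcongr <;> [exact (hU b).2; exact (hU' b).2]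
    _ ≤ δ := by rw [one_mul, mul_one, norm_sub_rev]; exact hUU' b

omit [NormedAlgebra ℂ 𝔸] in
include hU hU' hUU' in
/-- **`‖U(∂p) − U′(∂p)‖ ≤ 4δ`**: the plaquette holonomy (3.1) is a product of four unit-bounded factors, each `δ`-close to its counterpart.
[cite: Balaban1985BackgroundPropagators, (3.1) p.390, (3.5) p.391] -/
theorem norm_plaqHolU_sub_le (p : B9SectCLatticeCarrier.Plaq d Pd) : ‖(plaqHolU U p : 𝔸) - (plaqHolU U' p : 𝔸)‖ ≤ 4 * δ := by
  unfold plaqHolU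
  simp only [Units.val_mul]
  have h1 := hUU' (p.1, p.2.1.1)
  have h2 := hUU' (shift p.2.1.1 p.1, p.2.1.2)
  have h3 := norm_inv_sub_inv_le hU hU' hUU' (shift p.2.1.2 p.1, p.2.1.1)
  have h4 := norm_inv_sub_inv_le hU hU' hUU' (p.1, p.2.1.2)
  have n1 : ‖(U (p.1, p.2.1.1) : 𝔸)‖ ≤ 1 := (hU _).1
  have n12 : ‖(U (p.1, p.2.1.1) : 𝔸) * (U (shift p.2.1.1 p.1, p.2.1.2) : 𝔸)‖ ≤ 1 :=
    (norm_mul_le _ _).trans (mul_le_one₀ n1 (norm_nonneg _) (hU _).1)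
  have n123 : ‖(U (p.1, p.2.1.1) : 𝔸) * (U (shift p.2.1.1 p.1, p.2.1.2) : 𝔸) * (((U (shift p.2.1.2 p.1, p.2.1.1))⁻¹ : 𝔸ˣ) : 𝔸)‖ ≤ 1 :=
    (norm_mul_le _ _).trans (mul_le_one₀ n12 (norm_nonneg _) (hU _).2)
  have s12 := norm_mul_sub_mul_le₁ (a := (U (p.1, p.2.1.1) : 𝔸)) (a' := (U' (p.1, p.2.1.1) : 𝔸))
    (b := (U (shift p.2.1.1 p.1, p.2.1.2) : 𝔸)) (b' := (U' (shift p.2.1.1 p.1, p.2.1.2) : 𝔸)) n1 (hU' _).1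
  have s123 := norm_mul_sub_mul_le₁ (a := (U (p.1, p.2.1.1) : 𝔸) * (U (shift p.2.1.1 p.1, p.2.1.2) : 𝔸))
    (a' := (U' (p.1, p.2.1.1) : 𝔸) * (U' (shift p.2.1.1 p.1, p.2.1.2) : 𝔸))
    (b := (((U (shift p.2.1.2 p.1, p.2.1.1))⁻¹ : 𝔸ˣ) : 𝔸)) (b' := (((U' (shift p.2.1.2 p.1, p.2.1.1))⁻¹ : 𝔸ˣ) : 𝔸)) n12 (hU' _).2
  have s1234 := norm_mul_sub_mul_le₁
    (a := (U (p.1, p.2.1.1) : 𝔸) * (U (shift p.2.1.1 p.1, p.2.1.2) : 𝔸) * (((U (shift p.2.1.2 p.1, p.2.1.1))⁻¹ : 𝔸ˣ) : 𝔸))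
    (a' := (U' (p.1, p.2.1.1) : 𝔸) * (U' (shift p.2.1.1 p.1, p.2.1.2) : 𝔸) * (((U' (shift p.2.1.2 p.1, p.2.1.1))⁻¹ : 𝔸ˣ) : 𝔸))
    (b := (((U (p.1, p.2.1.2))⁻¹ : 𝔸ˣ) : 𝔸)) (b' := (((U' (p.1, p.2.1.2))⁻¹ : 𝔸ˣ) : 𝔸)) n123 (hU' _).2
  linarith

include hU hU' hUU' in
/-- `‖Re U(∂p) − Re U′(∂p)‖ ≤ 4δ` (`½(‖U(∂p) − U′(∂p)‖ + ‖U(∂p)⁻¹ − U′(∂p)⁻¹‖)`, the inverses as close as the holonomies).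
[cite: Balaban1985BackgroundPropagators, (3.7) p.391] -/
theorem norm_reHol_sub_le (p : B9SectCLatticeCarrier.Plaq d Pd) : ‖reHol U p - reHol U' p‖ ≤ 4 * δ := by
  have hP := norm_plaqHolU_sub_le hU hU' hUU' p
  have hPi : ‖(((plaqHolU U p)⁻¹ : 𝔸ˣ) : 𝔸) - (((plaqHolU U' p)⁻¹ : 𝔸ˣ) : 𝔸)‖ ≤ 4 * δ := by
    have h : (((plaqHolU U p)⁻¹ : 𝔸ˣ) : 𝔸) - (((plaqHolU U' p)⁻¹ : 𝔸ˣ) : 𝔸) =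
        (((plaqHolU U p)⁻¹ : 𝔸ˣ) : 𝔸) * ((plaqHolU U' p : 𝔸) - (plaqHolU U p : 𝔸)) * (((plaqHolU U' p)⁻¹ : 𝔸ˣ) : 𝔸) := by
      rw [mul_sub, sub_mul, mul_assoc, Units.mul_inv, mul_one, Units.inv_mul, one_mul]
    rw [h]
    calc _ ≤ ‖(((plaqHolU U p)⁻¹ : 𝔸ˣ) : 𝔸)‖ * ‖(plaqHolU U' p : 𝔸) - (plaqHolU U p : 𝔸)‖ * ‖(((plaqHolU U' p)⁻¹ : 𝔸ˣ) : 𝔸)‖ :=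
          (norm_mul_le _ _).trans (mul_le_mul_of_nonneg_right (norm_mul_le _ _) (norm_nonneg _))
      _ ≤ 1 * ‖(plaqHolU U' p : 𝔸) - (plaqHolU U p : 𝔸)‖ * 1 := by
          gcongr <;> [exact (norm_plaqHolU_le hU p).2; exact (norm_plaqHolU_le hU' p).2]
      _ ≤ 4 * δ := by rw [one_mul, mul_one, norm_sub_rev]; exact hP
  have h : reHol U p - reHol U' p = (1 / 2 : ℂ) • (((plaqHolU U p : 𝔸) - (plaqHolU U' p : 𝔸)) +
      ((((plaqHolU U p)⁻¹ : 𝔸ˣ) : 𝔸) - (((plaqHolU U' p)⁻¹ : 𝔸ˣ) : 𝔸))) := by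
    rw [reHol, reHol, ← smul_sub]; congr 1; abel
  rw [h, norm_smul, show ‖(1 / 2 : ℂ)‖ = 1 / 2 by simp]
  linarith [norm_add_le ((plaqHolU U p : 𝔸) - (plaqHolU U' p : 𝔸)) ((((plaqHolU U p)⁻¹ : 𝔸ˣ) : 𝔸) - (((plaqHolU U' p)⁻¹ : 𝔸ˣ) : 𝔸))]

include hU hU' hUU' in
/-- `‖Im U(∂p) − Im U′(∂p)‖ ≤ 4δ`. [cite: Balaban1985BackgroundPropagators, (3.7) p.391] -/
theorem norm_imHol_sub_le (p : B9SectCLatticeCarrier.Plaq d Pd) : ‖imHol U p - imHol U' p‖ ≤ 4 * δ := by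
  have hP := norm_plaqHolU_sub_le hU hU' hUU' p
  have hPi : ‖(((plaqHolU U p)⁻¹ : 𝔸ˣ) : 𝔸) - (((plaqHolU U' p)⁻¹ : 𝔸ˣ) : 𝔸)‖ ≤ 4 * δ := by
    have h : (((plaqHolU U p)⁻¹ : 𝔸ˣ) : 𝔸) - (((plaqHolU U' p)⁻¹ : 𝔸ˣ) : 𝔸) =
        (((plaqHolU U p)⁻¹ : 𝔸ˣ) : 𝔸) * ((plaqHolU U' p : 𝔸) - (plaqHolU U p : 𝔸)) * (((plaqHolU U' p)⁻¹ : 𝔸ˣ) : 𝔸) := by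
      rw [mul_sub, sub_mul, mul_assoc, Units.mul_inv, mul_one, Units.inv_mul, one_mul]
    rw [h]
    calc _ ≤ ‖(((plaqHolU U p)⁻¹ : 𝔸ˣ) : 𝔸)‖ * ‖(plaqHolU U' p : 𝔸) - (plaqHolU U p : 𝔸)‖ * ‖(((plaqHolU U' p)⁻¹ : 𝔸ˣ) : 𝔸)‖ :=
          (norm_mul_le _ _).trans (mul_le_mul_of_nonneg_right (norm_mul_le _ _) (norm_nonneg _))
      _ ≤ 1 * ‖(plaqHolU U' p : 𝔸) - (plaqHolU U p : 𝔸)‖ * 1 := by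
          gcongr <;> [exact (norm_plaqHolU_le hU p).2; exact (norm_plaqHolU_le hU' p).2]
      _ ≤ 4 * δ := by rw [one_mul, mul_one, norm_sub_rev]; exact hP
  have h : imHol U p - imHol U' p = (-Complex.I / 2) • (((plaqHolU U p : 𝔸) - (plaqHolU U' p : 𝔸)) -
      ((((plaqHolU U p)⁻¹ : 𝔸ˣ) : 𝔸) - (((plaqHolU U' p)⁻¹ : 𝔸ˣ) : 𝔸))) := by
    rw [imHol, imHol, ← smul_sub]; congr 1; abel
  rw [h, norm_smul, show ‖(-Complex.I / 2 : ℂ)‖ = 1 / 2 by simp]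
  linarith [norm_sub_le ((plaqHolU U p : 𝔸) - (plaqHolU U' p : 𝔸)) ((((plaqHolU U p)⁻¹ : 𝔸ˣ) : 𝔸) - (((plaqHolU U' p)⁻¹ : 𝔸ˣ) : 𝔸))]

omit [NormedAlgebra ℂ 𝔸] in
include hU hU' hUU' in
/-- conjugations by two unit-bounded bond variables differ by at most `2δ`: `‖UXU⁻¹ − U′XU′⁻¹‖ ≤ 2δ‖X‖`.
[cite: Balaban1985BackgroundPropagators, (3.2) p.390] -/
theorem norm_conj_sub_conj_le (b : Bond d Pd) (X : 𝔸) :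
    ‖(U b : 𝔸) * X * (((U b)⁻¹ : 𝔸ˣ) : 𝔸) - (U' b : 𝔸) * X * (((U' b)⁻¹ : 𝔸ˣ) : 𝔸)‖ ≤ 2 * δ * ‖X‖ := by
  have hinv := norm_inv_sub_inv_le hU hU' hUU' b
  rw [show (U b : 𝔸) * X * (((U b)⁻¹ : 𝔸ˣ) : 𝔸) - (U' b : 𝔸) * X * (((U' b)⁻¹ : 𝔸ˣ) : 𝔸) =
      ((U b : 𝔸) - (U' b : 𝔸)) * X * (((U b)⁻¹ : 𝔸ˣ) : 𝔸) + (U' b : 𝔸) * X * ((((U b)⁻¹ : 𝔸ˣ) : 𝔸) - (((U' b)⁻¹ : 𝔸ˣ) : 𝔸)) by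
    noncomm_ring]
  calc _ ≤ ‖((U b : 𝔸) - (U' b : 𝔸)) * X * (((U b)⁻¹ : 𝔸ˣ) : 𝔸)‖ + ‖(U' b : 𝔸) * X * ((((U b)⁻¹ : 𝔸ˣ) : 𝔸) - (((U' b)⁻¹ : 𝔸ˣ) : 𝔸))‖ :=
        norm_add_le _ _
    _ ≤ ‖(U b : 𝔸) - (U' b : 𝔸)‖ * ‖X‖ * ‖(((U b)⁻¹ : 𝔸ˣ) : 𝔸)‖ + ‖(U' b : 𝔸)‖ * ‖X‖ * ‖(((U b)⁻¹ : 𝔸ˣ) : 𝔸) - (((U' b)⁻¹ : 𝔸ˣ) : 𝔸)‖ :=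
        add_le_add ((norm_mul_le _ _).trans (mul_le_mul_of_nonneg_right (norm_mul_le _ _) (norm_nonneg _)))
          ((norm_mul_le _ _).trans (mul_le_mul_of_nonneg_right (norm_mul_le _ _) (norm_nonneg _)))
    _ ≤ δ * ‖X‖ * 1 + 1 * ‖X‖ * δ := by
        have hδ0 : 0 ≤ δ := (norm_nonneg _).trans (hUU' b)
        refine add_le_add ?_ ?_
        · exact mul_le_mul (mul_le_mul_of_nonneg_right (hUU' b) (norm_nonneg _)) (hU b).2 (norm_nonneg _) (by positivity)
        · exact mul_le_mul (mul_le_mul_of_nonneg_right (hU' b).1 (norm_nonneg _)) hinv (norm_nonneg _) (by positivity)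
    _ = 2 * δ * ‖X‖ := by ring

include hU hU' hUU' in
/-- **the transported edge variables of two backgrounds differ by at most `2δ‖A(b)‖`** (`A′(b)` is `A(b)`, `−A(b)` or a conjugate of it).
[cite: Balaban1985BackgroundPropagators, (3.2) p.390] -/
theorem norm_edgeLin_sub_le (p : B9SectCLatticeCarrier.Plaq d Pd) (k : Fin 4) (A : Bond d Pd → 𝔸) :
    ‖edgeLin U p k A - edgeLin U' p k A‖ ≤ 2 * δ * ‖A (edgeBond p k)‖ := by
  have hδ : 0 ≤ δ := (norm_nonneg _).trans (hUU' (p.1, p.2.1.1))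
  obtain ⟨x, q⟩ := p
  fin_cases k
  · show ‖edgeLin U (x, q) 0 A - edgeLin U' (x, q) 0 A‖ ≤ 2 * δ * ‖A (shift q.1.2 x, q.1.1)‖
    rw [edgeLin_zero, edgeLin_zero, neg_sub_neg, norm_sub_rev]
    exact norm_conj_sub_conj_le hU hU' hUU' _ _
  · show ‖edgeLin U (x, q) 1 A - edgeLin U' (x, q) 1 A‖ ≤ 2 * δ * ‖A (x, q.1.2)‖
    rw [edgeLin_one, edgeLin_one, sub_self, norm_zero]; positivity
  · show ‖edgeLin U (x, q) 2 A - edgeLin U' (x, q) 2 A‖ ≤ 2 * δ * ‖A (x, q.1.1)‖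
    rw [edgeLin_two, edgeLin_two, sub_self, norm_zero]; positivity
  · show ‖edgeLin U (x, q) 3 A - edgeLin U' (x, q) 3 A‖ ≤ 2 * δ * ‖A (shift q.1.1 x, q.1.2)‖
    rw [edgeLin_three, edgeLin_three]
    exact norm_conj_sub_conj_le hU hU' hUU' _ _

include hU hU' hUU' in
/-- **`‖(D_U A)(p) − (D_{U′}A)(p)‖ ≤ |c|·2δ·Σ_{b⊂∂p}‖A(b)‖`** ((3.4) as `c` times the sum of the transported edge variables).
[cite: Balaban1985BackgroundPropagators, (3.4) p.391] -/
theorem norm_curlAt_sub_le (c : ℂ) (p : B9SectCLatticeCarrier.Plaq d Pd) (A : Bond d Pd → 𝔸) :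
    ‖curlAt c U p A - curlAt c U' p A‖ ≤ ‖c‖ * (2 * δ) * edgeSum p A := by
  rw [curlAt_eq_smul_sum_edgeLin, curlAt_eq_smul_sum_edgeLin, ← smul_sub, norm_smul, ← sum_sub_distrib, mul_assoc]
  refine mul_le_mul_of_nonneg_left ?_ (norm_nonneg _)
  rw [edgeSum, mul_sum]
  exact (norm_sum_le _ _).trans (sum_le_sum fun k _ => norm_edgeLin_sub_le hU hU' hUU' p k A)

variable {τ : 𝔸 →ₗ[ℂ] ℂ} {Cτ : ℝ} (hτ : ∀ X, ‖τ X‖ ≤ Cτ * ‖X‖) (hCτ : 0 ≤ Cτ) (η : ℝ) {ε : ℝ} (hε1 : ε ≤ 1)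

omit [NormedAlgebra ℂ 𝔸] in
/-- three-factor telescoping: `‖XYM − X′Y′M′‖ ≤ ‖X − X′‖‖Y‖‖M‖ + ‖X′‖‖Y − Y′‖‖M‖ + ‖X′‖‖Y′‖‖M − M′‖`. [folklore] -/
private theorem norm_mul₃_sub_le (X X' Y Y' M M' : 𝔸) :
    ‖X * Y * M - X' * Y' * M'‖ ≤ ‖X - X'‖ * ‖Y‖ * ‖M‖ + ‖X'‖ * ‖Y - Y'‖ * ‖M‖ + ‖X'‖ * ‖Y'‖ * ‖M - M'‖ := by
  rw [show X * Y * M - X' * Y' * M' = (X - X') * Y * M + X' * (Y - Y') * M + X' * Y' * (M - M') by noncomm_ring]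
  refine (norm_add₃_le).trans (add_le_add (add_le_add ?_ ?_) ?_)
  · exact (norm_mul_le _ _).trans (mul_le_mul_of_nonneg_right (norm_mul_le _ _) (norm_nonneg _))
  · exact (norm_mul_le _ _).trans (mul_le_mul_of_nonneg_right (norm_mul_le _ _) (norm_nonneg _))
  · exact (norm_mul_le _ _).trans (mul_le_mul_of_nonneg_right (norm_mul_le _ _) (norm_nonneg _))

include hU hU' hUU' hτ hCτ hε1 in
/-- **the field-strength block of (3.10) between two backgrounds**: with the plaquette holonomy of `U` within `ε ≤ 1` of `1`,
`‖curvBlock₁(U) A B − curvBlock₁(U′) A B‖ ≤ 8·C_τ·δ·|η|⁻²·(Σ_{∂p}‖A‖)(Σ_{∂p}‖B‖)` (`τ(XYM) − τ(X′Y′M′)` telescoped: two `δε`-terms, one `δ`-term).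
[cite: Balaban1985BackgroundPropagators, (3.10) p.392, (3.69) p.404] -/
theorem norm_curvBlock₁_sub_le {p : B9SectCLatticeCarrier.Plaq d Pd} (hp : ‖(plaqHolU U p : 𝔸) - 1‖ ≤ ε) (A B : Bond d Pd → 𝔸) :
    ‖curvBlock₁ τ η U p A B - curvBlock₁ τ η U' p A B‖ ≤ 8 * Cτ * δ * ‖((η : ℂ))⁻¹‖ ^ 2 * edgeSum p A * edgeSum p B := by
  have hδ : 0 ≤ δ := (norm_nonneg _).trans (hUU' (p.1, p.2.1.1))
  have hε : 0 ≤ ε := (norm_nonneg _).trans hp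
  set c : ℂ := ((η : ℂ))⁻¹ with hc
  have hXA := norm_curlAt_le hU c p A
  have hXB := norm_curlAt_le hU c p B
  have hXA' := norm_curlAt_le hU' c p A
  have hXB' := norm_curlAt_le hU' c p B
  have hdA := norm_curlAt_sub_le hU hU' hUU' c p A
  have hdB := norm_curlAt_sub_le hU hU' hUU' c p B
  have hM : ‖reHol U p - 1‖ ≤ ε := norm_reHol_sub_one_le hU hp
  have hdM : ‖(reHol U p - 1) - (reHol U' p - 1)‖ ≤ 4 * δ := by rw [sub_sub_sub_cancel_right]; exact norm_reHol_sub_le hU hU' hUU' p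
  set eA := edgeSum p A
  set eB := edgeSum p B
  have heA : 0 ≤ eA := edgeSum_nonneg p A
  have heB : 0 ≤ eB := edgeSum_nonneg p B
  -- one `τ`-term
  have key : ∀ (X X' Y Y' : 𝔸) (x y : ℝ), ‖X‖ ≤ ‖c‖ * x → ‖X'‖ ≤ ‖c‖ * x → ‖Y‖ ≤ ‖c‖ * y → ‖Y'‖ ≤ ‖c‖ * y →
      ‖X - X'‖ ≤ ‖c‖ * (2 * δ) * x → ‖Y - Y'‖ ≤ ‖c‖ * (2 * δ) * y → 0 ≤ x → 0 ≤ y →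
      ‖τ (X * Y * (reHol U p - 1)) - τ (X' * Y' * (reHol U' p - 1))‖ ≤ Cτ * (8 * δ * ‖c‖ ^ 2 * x * y) := by
    intro X X' Y Y' x y hX hX' hY hY' hdX hdY hx hy
    rw [← map_sub]
    refine (hτ _).trans (mul_le_mul_of_nonneg_left ?_ hCτ)
    refine (norm_mul₃_sub_le X X' Y Y' _ _).trans ?_
    have t1 : ‖X - X'‖ * ‖Y‖ * ‖reHol U p - 1‖ ≤ (‖c‖ * (2 * δ) * x) * (‖c‖ * y) * ε :=
      mul_le_mul (mul_le_mul hdX hY (norm_nonneg _) (by positivity)) hM (norm_nonneg _) (by positivity)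
    have t2 : ‖X'‖ * ‖Y - Y'‖ * ‖reHol U p - 1‖ ≤ (‖c‖ * x) * (‖c‖ * (2 * δ) * y) * ε :=
      mul_le_mul (mul_le_mul hX' hdY (norm_nonneg _) (by positivity)) hM (norm_nonneg _) (by positivity)
    have t3 : ‖X'‖ * ‖Y'‖ * ‖(reHol U p - 1) - (reHol U' p - 1)‖ ≤ (‖c‖ * x) * (‖c‖ * y) * (4 * δ) :=
      mul_le_mul (mul_le_mul hX' hY' (norm_nonneg _) (by positivity)) hdM (norm_nonneg _) (by positivity)
    have hcx : 0 ≤ ‖c‖ ^ 2 * x * y * δ := by positivity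
    nlinarith [t1, t2, t3, hcx, mul_le_mul_of_nonneg_left hε1 hcx]
  rw [curvBlock₁_apply, curvBlock₁_apply, ← mul_sub, norm_mul, show ‖(1 / 2 : ℂ)‖ = 1 / 2 by simp,
    show τ (curlAt c U p A * curlAt c U p B * (reHol U p - 1)) + τ (curlAt c U p B * curlAt c U p A * (reHol U p - 1)) -
        (τ (curlAt c U' p A * curlAt c U' p B * (reHol U' p - 1)) + τ (curlAt c U' p B * curlAt c U' p A * (reHol U' p - 1))) =
      (τ (curlAt c U p A * curlAt c U p B * (reHol U p - 1)) - τ (curlAt c U' p A * curlAt c U' p B * (reHol U' p - 1))) +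
        (τ (curlAt c U p B * curlAt c U p A * (reHol U p - 1)) - τ (curlAt c U' p B * curlAt c U' p A * (reHol U' p - 1))) by abel]
  have h1 := key _ _ _ _ eA eB hXA hXA' hXB hXB' hdA hdB heA heB
  have h2 := key _ _ _ _ eB eA hXB hXB' hXA hXA' hdB hdA heB heA
  have := norm_add_le (τ (curlAt c U p A * curlAt c U p B * (reHol U p - 1)) - τ (curlAt c U' p A * curlAt c U' p B * (reHol U' p - 1)))
    (τ (curlAt c U p B * curlAt c U p A * (reHol U p - 1)) - τ (curlAt c U' p B * curlAt c U' p A * (reHol U' p - 1)))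
  nlinarith [mul_comm eA eB]

include hU hU' hUU' hτ hCτ hε1 in
/-- **the commutator block of (3.10) between two backgrounds**: `‖curvBlock₂(U) A B − curvBlock₂(U′) A B‖ ≤ 16·C_τ·δ·|η|⁻²·(Σ_{∂p}‖A‖)(Σ_{∂p}‖B‖)`
(plaquette holonomy of `U` within `ε ≤ 1` of `1`). [cite: Balaban1985BackgroundPropagators, (3.10) p.392, (3.69) p.404] -/
theorem norm_curvBlock₂_sub_le {p : B9SectCLatticeCarrier.Plaq d Pd} (hp : ‖(plaqHolU U p : 𝔸) - 1‖ ≤ ε) (A B : Bond d Pd → 𝔸) :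
    ‖curvBlock₂ τ η U p A B - curvBlock₂ τ η U' p A B‖ ≤ 16 * Cτ * δ * ‖((η : ℂ))⁻¹‖ ^ 2 * edgeSum p A * edgeSum p B := by
  have hδ : 0 ≤ δ := (norm_nonneg _).trans (hUU' (p.1, p.2.1.1))
  have hε : 0 ≤ ε := (norm_nonneg _).trans hp
  set M : 𝔸 := (((η : ℂ))⁻¹) ^ 2 • imHol U p with hM
  set M' : 𝔸 := (((η : ℂ))⁻¹) ^ 2 • imHol U' p with hM'
  have hMn : ‖M‖ ≤ ‖((η : ℂ))⁻¹‖ ^ 2 * ε := by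
    rw [hM, norm_smul, norm_pow]; exact mul_le_mul_of_nonneg_left (norm_imHol_le hU hp) (by positivity)
  have hdMn : ‖M - M'‖ ≤ ‖((η : ℂ))⁻¹‖ ^ 2 * (4 * δ) := by
    rw [hM, hM', ← smul_sub, norm_smul, norm_pow]
    exact mul_le_mul_of_nonneg_left (norm_imHol_sub_le hU hU' hUU' p) (by positivity)
  set a : Fin 4 → ℝ := fun k => ‖A (edgeBond p k)‖ with ha
  set b : Fin 4 → ℝ := fun k => ‖B (edgeBond p k)‖ with hb
  have hea : ∀ k, ‖edgeLin U p k A‖ ≤ a k := fun k => norm_edgeLin_le hU p k A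
  have heb : ∀ k, ‖edgeLin U p k B‖ ≤ b k := fun k => norm_edgeLin_le hU p k B
  have hea' : ∀ k, ‖edgeLin U' p k A‖ ≤ a k := fun k => norm_edgeLin_le hU' p k A
  have heb' : ∀ k, ‖edgeLin U' p k B‖ ≤ b k := fun k => norm_edgeLin_le hU' p k B
  have hda : ∀ k, ‖edgeLin U p k A - edgeLin U' p k A‖ ≤ 2 * δ * a k := fun k => norm_edgeLin_sub_le hU hU' hUU' p k A
  have hdb : ∀ k, ‖edgeLin U p k B - edgeLin U' p k B‖ ≤ 2 * δ * b k := fun k => norm_edgeLin_sub_le hU hU' hUU' p k B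
  -- a product of two edge variables between the backgrounds: `‖XY − X′Y′‖ ≤ 4δ·xy`
  have hprod : ∀ (X X' Y Y' : 𝔸) (x y : ℝ), ‖X‖ ≤ x → ‖Y'‖ ≤ y → ‖X - X'‖ ≤ 2 * δ * x → ‖Y - Y'‖ ≤ 2 * δ * y → 0 ≤ x → 0 ≤ y →
      ‖X * Y - X' * Y'‖ ≤ 4 * δ * (x * y) := by
    intro X X' Y Y' x y hX hY' hdX hdY hx hy
    rw [show X * Y - X' * Y' = X * (Y - Y') + (X - X') * Y' by noncomm_ring]
    calc _ ≤ ‖X‖ * ‖Y - Y'‖ + ‖X - X'‖ * ‖Y'‖ := (norm_add_le _ _).trans (add_le_add (norm_mul_le _ _) (norm_mul_le _ _))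
      _ ≤ x * (2 * δ * y) + (2 * δ * x) * y := add_le_add (mul_le_mul hX hdY (norm_nonneg _) hx) (mul_le_mul hdX hY' (norm_nonneg _) (by positivity))
      _ = 4 * δ * (x * y) := by ring
  -- one commutator-trace term between the backgrounds
  have key : ∀ (X X' Y Y' Xt Xt' Yt Yt' : 𝔸) (x y : ℝ),
      ‖X‖ ≤ x → ‖X'‖ ≤ x → ‖Y‖ ≤ y → ‖Y'‖ ≤ y → ‖Xt‖ ≤ y → ‖Xt'‖ ≤ y → ‖Yt‖ ≤ x → ‖Yt'‖ ≤ x →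
      ‖X - X'‖ ≤ 2 * δ * x → ‖Y - Y'‖ ≤ 2 * δ * y → ‖Xt - Xt'‖ ≤ 2 * δ * y → ‖Yt - Yt'‖ ≤ 2 * δ * x → 0 ≤ x → 0 ≤ y →
      ‖τ ((X * Y - Xt * Yt) * M) - τ ((X' * Y' - Xt' * Yt') * M')‖ ≤ Cτ * (16 * δ * ‖((η : ℂ))⁻¹‖ ^ 2 * (x * y)) := by
    intro X X' Y Y' Xt Xt' Yt Yt' x y hX hX' hY hY' hXt hXt' hYt hYt' hdX hdY hdXt hdYt hx hy
    rw [← map_sub]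
    refine (hτ _).trans (mul_le_mul_of_nonneg_left ?_ hCτ)
    rw [show (X * Y - Xt * Yt) * M - (X' * Y' - Xt' * Yt') * M' =
        ((X * Y - X' * Y') - (Xt * Yt - Xt' * Yt')) * M + (X' * Y' - Xt' * Yt') * (M - M') by noncomm_ring]
    have h1 : ‖X * Y - X' * Y'‖ ≤ 4 * δ * (x * y) := hprod X X' Y Y' x y hX hY' hdX hdY hx hy
    have h2 : ‖Xt * Yt - Xt' * Yt'‖ ≤ 4 * δ * (y * x) := hprod Xt Xt' Yt Yt' y x hXt hYt' hdXt hdYt hy hx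
    have h3 : ‖X' * Y' - Xt' * Yt'‖ ≤ 2 * (x * y) := by
      refine (norm_sub_le _ _).trans ?_
      have := (norm_mul_le X' Y').trans (mul_le_mul hX' hY' (norm_nonneg _) hx)
      have := (norm_mul_le Xt' Yt').trans (mul_le_mul hXt' hYt' (norm_nonneg _) hy)
      nlinarith [mul_comm x y]
    calc _ ≤ ‖((X * Y - X' * Y') - (Xt * Yt - Xt' * Yt')) * M‖ + ‖(X' * Y' - Xt' * Yt') * (M - M')‖ := norm_add_le _ _
      _ ≤ (‖X * Y - X' * Y'‖ + ‖Xt * Yt - Xt' * Yt'‖) * ‖M‖ + ‖X' * Y' - Xt' * Yt'‖ * ‖M - M'‖ :=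
          add_le_add ((norm_mul_le _ _).trans (mul_le_mul_of_nonneg_right (norm_sub_le _ _) (norm_nonneg _))) (norm_mul_le _ _)
      _ ≤ (4 * δ * (x * y) + 4 * δ * (y * x)) * (‖((η : ℂ))⁻¹‖ ^ 2 * ε) + (2 * (x * y)) * (‖((η : ℂ))⁻¹‖ ^ 2 * (4 * δ)) :=
          add_le_add (mul_le_mul (add_le_add h1 h2) hMn (norm_nonneg _) (by positivity)) (mul_le_mul h3 hdMn (norm_nonneg _) (by positivity))
      _ ≤ 16 * δ * ‖((η : ℂ))⁻¹‖ ^ 2 * (x * y) := by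
          have h0 : 0 ≤ δ * ‖((η : ℂ))⁻¹‖ ^ 2 * (x * y) := by positivity
          nlinarith [mul_le_mul_of_nonneg_left hε1 h0, mul_comm x y]
  rw [curvBlock₂_apply, curvBlock₂_apply, ← sum_sub_distrib]
  refine (norm_sum_le _ _).trans ?_
  have hterm : ∀ kl ∈ orderedPairs,
      ‖(Complex.I / 2 * (τ ((edgeLin U p kl.1 A * edgeLin U p kl.2 B - edgeLin U p kl.2 B * edgeLin U p kl.1 A) * M) +
          τ ((edgeLin U p kl.1 B * edgeLin U p kl.2 A - edgeLin U p kl.2 A * edgeLin U p kl.1 B) * M)) -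
        Complex.I / 2 * (τ ((edgeLin U' p kl.1 A * edgeLin U' p kl.2 B - edgeLin U' p kl.2 B * edgeLin U' p kl.1 A) * M') +
          τ ((edgeLin U' p kl.1 B * edgeLin U' p kl.2 A - edgeLin U' p kl.2 A * edgeLin U' p kl.1 B) * M')))‖ ≤
      Cτ * (16 * δ * ‖((η : ℂ))⁻¹‖ ^ 2) * (a kl.1 * b kl.2 + b kl.1 * a kl.2) := fun kl _ => by
    rw [← mul_sub, norm_mul, show ‖Complex.I / 2‖ = 1 / 2 by simp,
      show τ ((edgeLin U p kl.1 A * edgeLin U p kl.2 B - edgeLin U p kl.2 B * edgeLin U p kl.1 A) * M) +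
          τ ((edgeLin U p kl.1 B * edgeLin U p kl.2 A - edgeLin U p kl.2 A * edgeLin U p kl.1 B) * M) -
          (τ ((edgeLin U' p kl.1 A * edgeLin U' p kl.2 B - edgeLin U' p kl.2 B * edgeLin U' p kl.1 A) * M') +
            τ ((edgeLin U' p kl.1 B * edgeLin U' p kl.2 A - edgeLin U' p kl.2 A * edgeLin U' p kl.1 B) * M')) =
        (τ ((edgeLin U p kl.1 A * edgeLin U p kl.2 B - edgeLin U p kl.2 B * edgeLin U p kl.1 A) * M) -
            τ ((edgeLin U' p kl.1 A * edgeLin U' p kl.2 B - edgeLin U' p kl.2 B * edgeLin U' p kl.1 A) * M')) +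
          (τ ((edgeLin U p kl.1 B * edgeLin U p kl.2 A - edgeLin U p kl.2 A * edgeLin U p kl.1 B) * M) -
            τ ((edgeLin U' p kl.1 B * edgeLin U' p kl.2 A - edgeLin U' p kl.2 A * edgeLin U' p kl.1 B) * M')) by abel]
    have h1 := key _ _ _ _ _ _ _ _ (a kl.1) (b kl.2) (hea kl.1) (hea' kl.1) (heb kl.2) (heb' kl.2) (heb kl.2) (heb' kl.2) (hea kl.1) (hea' kl.1)
      (hda kl.1) (hdb kl.2) (hdb kl.2) (hda kl.1) (norm_nonneg _) (norm_nonneg _)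
    have h2 := key _ _ _ _ _ _ _ _ (b kl.1) (a kl.2) (heb kl.1) (heb' kl.1) (hea kl.2) (hea' kl.2) (hea kl.2) (hea' kl.2) (heb kl.1) (heb' kl.1)
      (hdb kl.1) (hda kl.2) (hda kl.2) (hdb kl.1) (norm_nonneg _) (norm_nonneg _)
    have := norm_add_le
      (τ ((edgeLin U p kl.1 A * edgeLin U p kl.2 B - edgeLin U p kl.2 B * edgeLin U p kl.1 A) * M) -
        τ ((edgeLin U' p kl.1 A * edgeLin U' p kl.2 B - edgeLin U' p kl.2 B * edgeLin U' p kl.1 A) * M'))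
      (τ ((edgeLin U p kl.1 B * edgeLin U p kl.2 A - edgeLin U p kl.2 A * edgeLin U p kl.1 B) * M) -
        τ ((edgeLin U' p kl.1 B * edgeLin U' p kl.2 A - edgeLin U' p kl.2 A * edgeLin U' p kl.1 B) * M'))
    have hR : 0 ≤ Cτ * (16 * δ * ‖((η : ℂ))⁻¹‖ ^ 2) * (a kl.1 * b kl.2 + b kl.1 * a kl.2) :=
      mul_nonneg (by positivity) (add_nonneg (mul_nonneg (norm_nonneg _) (norm_nonneg _)) (mul_nonneg (norm_nonneg _) (norm_nonneg _)))
    nlinarith [hR]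
  refine (sum_le_sum hterm).trans ?_
  rw [← mul_sum]
  -- `Σ_{k<l} (a_k b_l + b_k a_l) ≤ (Σ a)(Σ b)` (as in `B9Ineq369CurvatureSmall`)
  have hpairs : ∑ kl ∈ orderedPairs, (a kl.1 * b kl.2 + b kl.1 * a kl.2) ≤ edgeSum p A * edgeSum p B := by
    have hsub : ∑ kl ∈ orderedPairs, (a kl.1 * b kl.2 + b kl.1 * a kl.2) ≤ ∑ kl : Fin 4 × Fin 4, a kl.1 * b kl.2 := by
      rw [sum_add_distrib]
      have hswap : ∑ kl ∈ orderedPairs, b kl.1 * a kl.2 = ∑ kl ∈ orderedPairs.image Prod.swap, a kl.1 * b kl.2 := by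
        rw [sum_image (fun x _ y _ h => Prod.swap_injective h)]
        exact sum_congr rfl fun kl _ => by simp [mul_comm]
      rw [hswap, ← sum_union]
      · refine sum_le_sum_of_subset_of_nonneg (subset_univ _) fun kl _ _ => mul_nonneg (norm_nonneg _) (norm_nonneg _)
      · rw [disjoint_left]
        intro kl h1 h2
        rw [mem_orderedPairs] at h1
        obtain ⟨kl', h2', rfl⟩ := mem_image.1 h2
        rw [mem_orderedPairs] at h2'
        simp only [Prod.fst_swap, Prod.snd_swap] at h1
        exact lt_asymm h1 h2'
    refine hsub.trans (le_of_eq ?_)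
    rw [edgeSum, edgeSum, sum_mul_sum, ← univ_product_univ, sum_product]
  have hc : 0 ≤ Cτ * (16 * δ * ‖((η : ℂ))⁻¹‖ ^ 2) := by positivity
  nlinarith [mul_le_mul_of_nonneg_left hpairs hc]

include hU hU' hUU' hτ hCτ hε1 in
/-- **`‖⟨A, (Δ′(U) − Δ′(U′))B⟩_{(3.10)}‖ ≤ 24·C_τ·δ·|η|^d·|η|⁻²·Σ_p (Σ_{∂p}‖A‖)(Σ_{∂p}‖B‖)`** — the curvature form is `O(δ)`-Lipschitz in the background,
plaquette by plaquette. [cite: Balaban1985BackgroundPropagators, (3.10) p.392, (3.69) p.404] -/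
theorem norm_curvForm_sub_le (hpl : ∀ p : B9SectCLatticeCarrier.Plaq d Pd, ‖(plaqHolU U p : 𝔸) - 1‖ ≤ ε) (A B : Bond d Pd → 𝔸) :
    ‖curvForm τ η U A B - curvForm τ η U' A B‖ ≤
      24 * Cτ * δ * |η| ^ d * ‖((η : ℂ))⁻¹‖ ^ 2 * ∑ p : B9SectCLatticeCarrier.Plaq d Pd, edgeSum p A * edgeSum p B := by
  rw [curvForm_apply, curvForm_apply, ← sum_sub_distrib, mul_sum]
  refine (norm_sum_le _ _).trans (sum_le_sum fun p _ => ?_)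
  rw [← mul_sub, norm_mul, norm_pow, Complex.norm_real, Real.norm_eq_abs,
    show curvBlock₁ τ η U p A B + curvBlock₂ τ η U p A B - (curvBlock₁ τ η U' p A B + curvBlock₂ τ η U' p A B) =
      (curvBlock₁ τ η U p A B - curvBlock₁ τ η U' p A B) + (curvBlock₂ τ η U p A B - curvBlock₂ τ η U' p A B) by abel]
  have h1 := norm_curvBlock₁_sub_le hU hU' hUU' hτ hCτ η hε1 (hpl p) A B
  have h2 := norm_curvBlock₂_sub_le hU hU' hUU' hτ hCτ η hε1 (hpl p) A B
  have h := norm_add_le (curvBlock₁ τ η U p A B - curvBlock₁ τ η U' p A B) (curvBlock₂ τ η U p A B - curvBlock₂ τ η U' p A B)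
  have hpos : 0 ≤ |η| ^ d := by positivity
  nlinarith [mul_le_mul_of_nonneg_left (h.trans (add_le_add h1 h2)) hpos]

end Plaquette

/-! ## §2 On the `L²` bond space: `Δ′(U) − Δ′(U′)` is `O(δ)` in operator norm -/

section L2

variable {𝔸 : Type*} [NormedRing 𝔸] [NormedAlgebra ℂ 𝔸] [StarRing 𝔸] [NormedStarGroup 𝔸] [StarModule ℂ 𝔸]
  {W : Type*} [NormedAddCommGroup W] [InnerProductSpace ℂ W] [FiniteDimensional ℂ W] (φ : W ≃ₗ[ℂ] 𝔸) {c₀ : ℝ} [Fact (0 < c₀)]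
  {τ : 𝔸 →ₗ[ℂ] ℂ} {Cτ : ℝ} (hτ : ∀ X, ‖τ X‖ ≤ Cτ * ‖X‖) (hCτ : 0 ≤ Cτ) {Mφ : ℝ} (hφ : ∀ w, ‖φ w‖ ≤ Mφ * ‖w‖) (η : ℝ)
  {U U' : Bond d Pd → 𝔸ˣ} (hU : ∀ b, ‖(U b : 𝔸)‖ ≤ 1 ∧ ‖(((U b)⁻¹ : 𝔸ˣ) : 𝔸)‖ ≤ 1)
  (hU' : ∀ b, ‖(U' b : 𝔸)‖ ≤ 1 ∧ ‖(((U' b)⁻¹ : 𝔸ˣ) : 𝔸)‖ ≤ 1) {δ : ℝ} (hδ : 0 ≤ δ) (hUU' : ∀ b, ‖(U b : 𝔸) - (U' b : 𝔸)‖ ≤ δ)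
  {ε : ℝ} (hε1 : ε ≤ 1) (hpl : ∀ p : B9SectCLatticeCarrier.Plaq d Pd, ‖(plaqHolU U p : 𝔸) - 1‖ ≤ ε)

include hτ hCτ hφ hU hU' hδ hUU' hε1 hpl in
/-- **the bilinear form of `Δ′(U) − Δ′(U′)` is `O(δ)`**: `‖⟪y, (Δ′(U) − Δ′(U′))x⟫‖ ≤ 384d·C_τ·M_φ²·(|η|^d∕c₀)·(|η|⁻²δ)·‖x‖·‖y‖` (§1 + Cauchy–Schwarz over the
plaquettes + the `4d` incidence count, as `B9Ineq369CurvatureOperatorBound.norm_inner_curvOp_le`). [cite: Balaban1985BackgroundPropagators, p.392, (3.69) p.404] -/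
theorem norm_inner_curvOp_sub_le (hMφ : 0 ≤ Mφ) (y x : BondL2K ℂ d Pd c₀ W) :
    ‖⟪y, curvOp φ τ η U x - curvOp φ τ η U' x⟫_ℂ‖ ≤ 384 * d * Cτ * Mφ ^ 2 * (|η| ^ d / c₀) * (‖((η : ℂ))⁻¹‖ ^ 2 * δ) * ‖x‖ * ‖y‖ := by
  have hc₀ : 0 < c₀ := Fact.out
  rw [inner_sub_right, inner_curvOp, inner_curvOp]
  have hstar : ∀ p, edgeSum p (star (toAlg φ y)) = edgeSum p (toAlg φ y) :=
    fun p => sum_congr rfl fun k _ => by rw [Pi.star_apply, norm_star]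
  have h1 : ‖curvForm τ η U (star (toAlg φ y)) (toAlg φ x) - curvForm τ η U' (star (toAlg φ y)) (toAlg φ x)‖ ≤
      24 * Cτ * δ * |η| ^ d * ‖((η : ℂ))⁻¹‖ ^ 2 * ∑ p : B9SectCLatticeCarrier.Plaq d Pd, edgeSum p (toAlg φ y) * edgeSum p (toAlg φ x) := by
    refine (norm_curvForm_sub_le hU hU' hUU' hτ hCτ η hε1 hpl _ _).trans (le_of_eq ?_)
    congr 1
    exact sum_congr rfl fun p _ => by rw [hstar]
  -- Cauchy–Schwarz over the plaquettes
  have hCS : ∑ p : B9SectCLatticeCarrier.Plaq d Pd, edgeSum p (toAlg φ y) * edgeSum p (toAlg φ x) ≤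
      Real.sqrt (∑ p : B9SectCLatticeCarrier.Plaq d Pd, edgeSum p (toAlg φ y) ^ 2) *
        Real.sqrt (∑ p : B9SectCLatticeCarrier.Plaq d Pd, edgeSum p (toAlg φ x) ^ 2) := by
    have h := Real.sum_mul_le_sqrt_mul_sqrt (univ : Finset (B9SectCLatticeCarrier.Plaq d Pd)) (fun p => edgeSum p (toAlg φ y))
      (fun p => edgeSum p (toAlg φ x))
    simpa using h
  have hy := sum_edgeSum_sq_le y (toAlg φ y) (fun b => hφ _)
  have hx := sum_edgeSum_sq_le x (toAlg φ x) (fun b => hφ _)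
  have hsd : Real.sqrt d ^ 2 = d := Real.sq_sqrt (Nat.cast_nonneg d)
  have hsc : Real.sqrt c₀ ^ 2 = c₀ := Real.sq_sqrt hc₀.le
  have hsc0 : 0 < Real.sqrt c₀ := Real.sqrt_pos.2 hc₀
  have hroot : ∀ (z : BondL2K ℂ d Pd c₀ W), ∑ p : B9SectCLatticeCarrier.Plaq d Pd, edgeSum p (toAlg φ z) ^ 2 ≤ 16 * d * Mφ ^ 2 * (‖z‖ ^ 2 / c₀) →
      Real.sqrt (∑ p : B9SectCLatticeCarrier.Plaq d Pd, edgeSum p (toAlg φ z) ^ 2) ≤ 4 * Real.sqrt d * Mφ * ‖z‖ / Real.sqrt c₀ := fun z hz => by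
    have ha : 0 ≤ 4 * Real.sqrt d * Mφ * ‖z‖ / Real.sqrt c₀ := by positivity
    have hsq : (4 * Real.sqrt d * Mφ * ‖z‖ / Real.sqrt c₀) ^ 2 = 16 * d * Mφ ^ 2 * (‖z‖ ^ 2 / c₀) := by
      rw [div_pow, show (4 * Real.sqrt d * Mφ * ‖z‖) ^ 2 = 16 * Real.sqrt d ^ 2 * Mφ ^ 2 * ‖z‖ ^ 2 by ring, hsd, hsc]; ring
    calc Real.sqrt (∑ p : B9SectCLatticeCarrier.Plaq d Pd, edgeSum p (toAlg φ z) ^ 2) ≤ Real.sqrt ((4 * Real.sqrt d * Mφ * ‖z‖ / Real.sqrt c₀) ^ 2) :=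
          Real.sqrt_le_sqrt (by rw [hsq]; exact hz)
      _ = 4 * Real.sqrt d * Mφ * ‖z‖ / Real.sqrt c₀ := Real.sqrt_sq ha
  have hprod : ∑ p : B9SectCLatticeCarrier.Plaq d Pd, edgeSum p (toAlg φ y) * edgeSum p (toAlg φ x) ≤
      (4 * Real.sqrt d * Mφ * ‖y‖ / Real.sqrt c₀) * (4 * Real.sqrt d * Mφ * ‖x‖ / Real.sqrt c₀) :=
    hCS.trans (mul_le_mul (hroot y hy) (hroot x hx) (Real.sqrt_nonneg _) (by positivity))
  have hA : 0 ≤ 24 * Cτ * δ * |η| ^ d * ‖((η : ℂ))⁻¹‖ ^ 2 := by positivity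
  calc ‖curvForm τ η U (star (toAlg φ y)) (toAlg φ x) - curvForm τ η U' (star (toAlg φ y)) (toAlg φ x)‖
      ≤ 24 * Cτ * δ * |η| ^ d * ‖((η : ℂ))⁻¹‖ ^ 2 * ∑ p : B9SectCLatticeCarrier.Plaq d Pd, edgeSum p (toAlg φ y) * edgeSum p (toAlg φ x) := h1
    _ ≤ 24 * Cτ * δ * |η| ^ d * ‖((η : ℂ))⁻¹‖ ^ 2 * ((4 * Real.sqrt d * Mφ * ‖y‖ / Real.sqrt c₀) * (4 * Real.sqrt d * Mφ * ‖x‖ / Real.sqrt c₀)) :=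
        mul_le_mul_of_nonneg_left hprod hA
    _ = 384 * d * Cτ * Mφ ^ 2 * (|η| ^ d / c₀) * (‖((η : ℂ))⁻¹‖ ^ 2 * δ) * ‖x‖ * ‖y‖ := by
        rw [show (4 * Real.sqrt d * Mφ * ‖y‖ / Real.sqrt c₀) * (4 * Real.sqrt d * Mφ * ‖x‖ / Real.sqrt c₀) =
          16 * Real.sqrt d ^ 2 * Mφ ^ 2 * ‖x‖ * ‖y‖ / Real.sqrt c₀ ^ 2 by rw [div_mul_div_comm]; ring, hsd, hsc]
        ring

include hτ hCτ hφ hU hU' hδ hUU' hε1 hpl in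
/-- **`Δ′(U) − Δ′(U′)` IS `O(δ)` ON THE `L²` BOND SPACE**: `‖Δ′(U)x − Δ′(U′)x‖ ≤ 384d·C_τ·M_φ²·(|η|^d∕c₀)·(|η|⁻²δ)·‖x‖` — the operator-norm form, from the
bilinear bound with `y := (Δ′(U) − Δ′(U′))x`. [cite: Balaban1985BackgroundPropagators, p.392, (3.69) p.404] -/
theorem norm_curvOp_sub_le (hMφ : 0 ≤ Mφ) (x : BondL2K ℂ d Pd c₀ W) :
    ‖curvOp φ τ η U x - curvOp φ τ η U' x‖ ≤ 384 * d * Cτ * Mφ ^ 2 * (|η| ^ d / c₀) * (‖((η : ℂ))⁻¹‖ ^ 2 * δ) * ‖x‖ := by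
  have hc₀ : 0 < c₀ := Fact.out
  have h1 : ‖curvOp φ τ η U x - curvOp φ τ η U' x‖ ^ 2 ≤
      384 * d * Cτ * Mφ ^ 2 * (|η| ^ d / c₀) * (‖((η : ℂ))⁻¹‖ ^ 2 * δ) * ‖x‖ * ‖curvOp φ τ η U x - curvOp φ τ η U' x‖ := by
    rw [← inner_self_eq_norm_sq (𝕜 := ℂ)]
    exact (RCLike.re_le_norm _).trans (norm_inner_curvOp_sub_le φ hτ hCτ hφ η hU hU' hδ hUU' hε1 hpl hMφ _ x)
  rcases eq_or_lt_of_le (norm_nonneg (curvOp φ τ η U x - curvOp φ τ η U' x)) with h0 | hpos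
  · rw [← h0]; positivity
  · have : ‖curvOp φ τ η U x - curvOp φ τ η U' x‖ * ‖curvOp φ τ η U x - curvOp φ τ η U' x‖ ≤
        (384 * d * Cτ * Mφ ^ 2 * (|η| ^ d / c₀) * (‖((η : ℂ))⁻¹‖ ^ 2 * δ) * ‖x‖) * ‖curvOp φ τ η U x - curvOp φ τ η U' x‖ := by
      nlinarith
    exact le_of_mul_le_mul_right this hpos

end L2

end Literature.MathematicalPhysics.QuantumFieldTheory.Balaban1983to89.B9Ineq369CurvatureTwoBackgrounds

end
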